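import Summits.Schanuel.Schanuel.Theorems.RootDecomp1KHyper21

/-!
# RootDecomp1KHyper — lens 6, generation 15 «QUAD-ANCHORED CELL» (QuadAnchor.lean 33b3769e…, 2400 l) — continuation (RootDecomp1KHyper22): §4 first half: `HasRealQuadAnchor` (span-intrinsic, `GL₃(ℤ)`-invariant, padding-monotone), `cvec` cross products, `quad_lower_bound`, `exists_cvec_ne_zero`, `exists_level_dot_ne_zero`

(lens-6 g15 `QuadAnchor.lean`, sha256 33b3769e…6b415, farm rc 0 · 0 sorry · axioms standard; port by census-1 gen 14 in eight parts RootDecomp1KHyper20–27 at the section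
cuts of CENSUS-REQUEST 2026-08-31T01:16:56Z (STATUS L1528; §5 cut at §5b; §3's three engine corollaries moved to where they are first used); each part imports the
previous; statements and proofs verbatim (54 one-line docstrings added, six generic one-liners privatised with per-part private copies, the two `linter.*` options dropped, two unused binders renamed `_`); `hLW : LWMeasure` (tree-proved
named fact) stays a binder where marked; `--supports stmt-Schanuel-33363` (A₄ʰ HyperLiouvilleSchanuel, residual of record `Rank3SpanResidual`). Nothing here proves Schanuel; rung 0.)
-/

noncomputable section

open Complex IntermediateField Polynomial

namespace Summit.Schanuel.Schanuel.Theorems.RootDecomp1KHyper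

namespace HyperCell
variable {n : ℕ}
open Summit.Schanuel.Schanuel.Theorems.RootDecomp1KGeneric (HasHLPairInSpan Rank3SpanResidual
  mem_adjoin_of_mem_span cexp_mem_adjoin_of_mem_span)

/-- `exp(−x) ≤ 1/x` for `x > 0`. -/
private theorem exp_neg_le_one_div' {x : ℝ} (hx : 0 < x) : Real.exp (-x) ≤ 1 / x := by
  rw [Real.exp_neg, ← one_div]
  exact one_div_le_one_div_of_le hx (by linarith [Real.add_one_le_exp x])

set_option maxHeartbeats 1000000 in

/-! ## 4. The real-quadratic-anchored cell: extraction of `HyperQuadApprox` from the small forms -/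

open Summit.Schanuel.Schanuel.Theorems.RootDecomp1KGeneric (HasHLPairInSpan Rank3SpanResidual
  mem_adjoin_of_mem_span cexp_mem_adjoin_of_mem_span)

/-- **`HasRealQuadAnchor z`** — the ℤ-span of the tuple contains a non-zero RATIONAL `q₁` and a
non-zero rational multiple `q₂√D` of a real quadratic IRRATIONALITY `√D`.  A property of the lattice
`span_ℤ(z)` only: invariant under `GL_N(ℤ)` re-basing of the tuple (and padding-monotone). -/
def HasRealQuadAnchor {N : ℕ} (z : Fin N → ℂ) : Prop :=
  ∃ (D : ℕ) (q₁ q₂ : ℚ), Irrational (Real.sqrt D) ∧ q₁ ≠ 0 ∧ q₂ ≠ 0 ∧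
    (q₁ : ℂ) ∈ Submodule.span ℤ (Set.range z) ∧
    (q₂ : ℂ) * ((Real.sqrt D : ℝ) : ℂ) ∈ Submodule.span ℤ (Set.range z)

/-- RULE K-R10 (gauge): the anchor only sees the lattice `span_ℤ(z)` — it is monotone in the span,
hence invariant under `GL_N(ℤ)` re-basing (equal spans) and persists under padding (larger span). -/
theorem HasRealQuadAnchor.mono {N N' : ℕ} {z : Fin N → ℂ} {z' : Fin N' → ℂ}
    (hle : Submodule.span ℤ (Set.range z) ≤ Submodule.span ℤ (Set.range z')) :
    HasRealQuadAnchor z → HasRealQuadAnchor z' := by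
  rintro ⟨D, q₁, q₂, hD, h1, h2, hm1, hm2⟩
  exact ⟨D, q₁, q₂, hD, h1, h2, hle hm1, hle hm2⟩

/-- `HasRealQuadAnchor` depends only on the `ℤ`-span of the tuple: tuples with equal spans are anchored simultaneously. -/
theorem hasRealQuadAnchor_congr_span {N N' : ℕ} {z : Fin N → ℂ} {z' : Fin N' → ℂ}
    (heq : Submodule.span ℤ (Set.range z) = Submodule.span ℤ (Set.range z')) :
    HasRealQuadAnchor z ↔ HasRealQuadAnchor z' :=
  ⟨HasRealQuadAnchor.mono heq.le, HasRealQuadAnchor.mono heq.ge⟩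

/-- Integer cross product on `Fin 3`. -/
def cvec (u v : Fin 3 → ℤ) : Fin 3 → ℤ :=
  ![u 1 * v 2 - u 2 * v 1, u 2 * v 0 - u 0 * v 2, u 0 * v 1 - u 1 * v 0]

/-- Coordinate `0` of the integer cross product `cvec u v`. -/
@[simp] theorem cvec_zero (u v : Fin 3 → ℤ) : cvec u v 0 = u 1 * v 2 - u 2 * v 1 := rfl
/-- Coordinate `1` of the integer cross product `cvec u v`. -/
@[simp] theorem cvec_one (u v : Fin 3 → ℤ) : cvec u v 1 = u 2 * v 0 - u 0 * v 2 := rfl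
/-- Coordinate `2` of the integer cross product `cvec u v`. -/
@[simp] theorem cvec_two (u v : Fin 3 → ℤ) : cvec u v 2 = u 0 * v 1 - u 1 * v 0 := rfl

/-- **KEY IDENTITY**: `c_j · (h·z) = (h×b)_j (a·z) + (a×h)_j (b·z) + (c·h) z_j`, `c = a × b`. -/
theorem cvec_key (a b h : Fin 3 → ℤ) (z : Fin 3 → ℂ) (j : Fin 3) :
    (cvec a b j : ℂ) * ∑ i, (h i : ℂ) * z i =
      (cvec h b j : ℂ) * ∑ i, (a i : ℂ) * z i + (cvec a h j : ℂ) * ∑ i, (b i : ℂ) * z i +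
        ((∑ i, cvec a b i * h i : ℤ) : ℂ) * z j := by
  rw [Fin.sum_univ_three, Fin.sum_univ_three, Fin.sum_univ_three, Fin.sum_univ_three]
  match j with
  | 0 => simp only [cvec_zero, cvec_one, cvec_two]; push_cast; ring
  | 1 => simp only [cvec_zero, cvec_one, cvec_two]; push_cast; ring
  | 2 => simp only [cvec_zero, cvec_one, cvec_two]; push_cast; ring

/-- Elementary bound `|x·y − x'·y'| ≤ S·T` from `|x|, |x'| ≤ S`, `|y| + |y'| ≤ T`, `0 ≤ S`. -/
private theorem abs_mul_sub_mul_le {x x' y y' S T : ℝ} (hx : |x| ≤ S) (hx' : |x'| ≤ S)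
    (hy : |y| + |y'| ≤ T) (hS : 0 ≤ S) : |x * y - x' * y'| ≤ S * T :=
  calc |x * y - x' * y'| ≤ |x * y| + |x' * y'| := abs_sub _ _
    _ = |x| * |y| + |x'| * |y'| := by rw [abs_mul, abs_mul]
    _ ≤ S * |y| + S * |y'| :=
        add_le_add (mul_le_mul_of_nonneg_right hx (abs_nonneg _))
          (mul_le_mul_of_nonneg_right hx' (abs_nonneg _))
    _ = S * (|y| + |y'|) := by ring
    _ ≤ S * T := mul_le_mul_of_nonneg_left hy hS

/-- `|(u × v)_j| ≤ |u|₁ |v|₁`. -/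
theorem abs_cvec_le (u v : Fin 3 → ℤ) (j : Fin 3) :
    |(cvec u v j : ℝ)| ≤ (∑ i, |(u i : ℝ)|) * ∑ i, |(v i : ℝ)| := by
  have hu : ∀ i, |(u i : ℝ)| ≤ ∑ i, |(u i : ℝ)| := fun i =>
    Finset.single_le_sum (f := fun i => |(u i : ℝ)|) (fun _ _ => abs_nonneg _) (Finset.mem_univ i)
  have hS : (0 : ℝ) ≤ ∑ i, |(u i : ℝ)| := Finset.sum_nonneg fun _ _ => abs_nonneg _
  have hv3 : ∑ i, |(v i : ℝ)| = |(v 0 : ℝ)| + |(v 1 : ℝ)| + |(v 2 : ℝ)| := by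
    rw [Fin.sum_univ_three]
  have h0 := abs_nonneg (v 0 : ℝ)
  have h1 := abs_nonneg (v 1 : ℝ)
  have h2 := abs_nonneg (v 2 : ℝ)
  match j with
  | 0 =>
      rw [cvec_zero]; push_cast
      exact abs_mul_sub_mul_le (hu 1) (hu 2) (by rw [hv3]; linarith) hS
  | 1 =>
      rw [cvec_one]; push_cast
      exact abs_mul_sub_mul_le (hu 2) (hu 0) (by rw [hv3]; linarith) hS
  | 2 =>
      rw [cvec_two]; push_cast
      exact abs_mul_sub_mul_le (hu 0) (hu 1) (by rw [hv3]; linarith) hS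

/-- `|c · h| ≤ |c|₁ |h|₁`. -/
theorem abs_dot_le (c h : Fin 3 → ℤ) :
    |((∑ i, c i * h i : ℤ) : ℝ)| ≤ (∑ i, |(c i : ℝ)|) * ∑ i, |(h i : ℝ)| := by
  have hh : ∀ i, |(h i : ℝ)| ≤ ∑ i, |(h i : ℝ)| := fun i =>
    Finset.single_le_sum (f := fun i => |(h i : ℝ)|) (fun _ _ => abs_nonneg _) (Finset.mem_univ i)
  push_cast
  calc |∑ i, (c i : ℝ) * h i| ≤ ∑ i, |(c i : ℝ) * h i| := Finset.abs_sum_le_sum_abs _ _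
    _ = ∑ i, |(c i : ℝ)| * |(h i : ℝ)| := by simp_rw [abs_mul]
    _ ≤ ∑ i, |(c i : ℝ)| * ∑ k, |(h k : ℝ)| :=
        Finset.sum_le_sum fun i _ => mul_le_mul_of_nonneg_left (hh i) (abs_nonneg _)
    _ = (∑ i, |(c i : ℝ)|) * ∑ i, |(h i : ℝ)| := by rw [Finset.sum_mul]

/-- **Liouville's inequality for a real quadratic irrationality**:
`|U + V√D| ≥ 1/(|U| + |V|√D + 1)` for integers `(U, V) ≠ (0, 0)`. -/
theorem quad_lower_bound {D : ℕ} (hD : Irrational (Real.sqrt D)) (U V : ℤ) (hUV : U ≠ 0 ∨ V ≠ 0) :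
    1 / (|(U : ℝ)| + |(V : ℝ)| * Real.sqrt D + 1) ≤ |(U : ℝ) + V * Real.sqrt D| := by
  have hs0 : 0 ≤ Real.sqrt D := Real.sqrt_nonneg _
  have hs2 : Real.sqrt D ^ 2 = (D : ℝ) := Real.sq_sqrt (Nat.cast_nonneg D)
  have hN : (U : ℝ) ^ 2 - (D : ℝ) * (V : ℝ) ^ 2 ≠ 0 := by
    intro h0
    have hV : V ≠ 0 := by
      intro hV
      rw [hV] at h0
      have hU : (U : ℝ) = 0 := by simpa using h0
      rcases hUV with hU' | hV'
      · exact hU' (by exact_mod_cast hU)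
      · exact hV' hV
    have hVR : (V : ℝ) ≠ 0 := by exact_mod_cast hV
    have hDsq : ((U : ℝ) / V) ^ 2 = (D : ℝ) := by
      rw [div_pow, div_eq_iff (pow_ne_zero 2 hVR)]; linarith
    refine hD ⟨|(U : ℚ) / V|, ?_⟩
    push_cast
    rw [← hDsq, Real.sqrt_sq_eq_abs]
  have hN1 : 1 ≤ |(U : ℝ) ^ 2 - (D : ℝ) * (V : ℝ) ^ 2| := by
    have e : ((U ^ 2 - (D : ℤ) * V ^ 2 : ℤ) : ℝ) = (U : ℝ) ^ 2 - (D : ℝ) * (V : ℝ) ^ 2 := by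
      push_cast; ring
    have hNZ : (U ^ 2 - (D : ℤ) * V ^ 2 : ℤ) ≠ 0 := by
      intro h; apply hN; rw [← e, h]; simp
    rw [← e, ← Int.cast_abs]
    exact_mod_cast Int.one_le_abs hNZ
  have hfac : (U : ℝ) ^ 2 - (D : ℝ) * (V : ℝ) ^ 2 =
      ((U : ℝ) + V * Real.sqrt D) * ((U : ℝ) - V * Real.sqrt D) := by
    have e : ((U : ℝ) + V * Real.sqrt D) * ((U : ℝ) - V * Real.sqrt D) =
        (U : ℝ) ^ 2 - Real.sqrt D ^ 2 * (V : ℝ) ^ 2 := by ring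
    rw [e, hs2]
  have hconj : |(U : ℝ) - V * Real.sqrt D| ≤ |(U : ℝ)| + |(V : ℝ)| * Real.sqrt D + 1 := by
    calc |(U : ℝ) - V * Real.sqrt D| ≤ |(U : ℝ)| + |(V : ℝ) * Real.sqrt D| := abs_sub _ _
      _ = |(U : ℝ)| + |(V : ℝ)| * Real.sqrt D := by rw [abs_mul, abs_of_nonneg hs0]
      _ ≤ _ := by linarith
  have hpos : 0 < |(U : ℝ)| + |(V : ℝ)| * Real.sqrt D + 1 := by positivity
  rw [div_le_iff₀ hpos]
  calc (1 : ℝ) ≤ |(U : ℝ) ^ 2 - (D : ℝ) * (V : ℝ) ^ 2| := hN1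
    _ = |(U : ℝ) + V * Real.sqrt D| * |(U : ℝ) - V * Real.sqrt D| := by rw [hfac, abs_mul]
    _ ≤ |(U : ℝ) + V * Real.sqrt D| * (|(U : ℝ)| + |(V : ℝ)| * Real.sqrt D + 1) :=
        mul_le_mul_of_nonneg_left hconj (abs_nonneg _)

/-- The two anchor coefficient vectors are not parallel: some component of `a × b` is non-zero. -/
theorem exists_cvec_ne_zero {z : Fin 3 → ℂ} {D : ℕ} (hD : Irrational (Real.sqrt D)) {q₁ q₂ : ℚ}
    (hq₁ : q₁ ≠ 0) (hq₂ : q₂ ≠ 0) {a b : Fin 3 → ℤ} (ha : ∑ i, (a i : ℂ) * z i = (q₁ : ℂ))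
    (hb : ∑ i, (b i : ℂ) * z i = (q₂ : ℂ) * ((Real.sqrt D : ℝ) : ℂ)) : ∃ j, cvec a b j ≠ 0 := by
  by_contra hall
  push Not at hall
  have h0 : (a 1 : ℂ) * b 2 - a 2 * b 1 = 0 := by exact_mod_cast hall 0
  have h1 : (a 2 : ℂ) * b 0 - a 0 * b 2 = 0 := by exact_mod_cast hall 1
  have h2 : (a 0 : ℂ) * b 1 - a 1 * b 0 = 0 := by exact_mod_cast hall 2
  have ha0 : a ≠ 0 := by
    intro h
    have : (q₁ : ℂ) = 0 := by rw [← ha]; simp [h]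
    exact hq₁ (by exact_mod_cast this)
  obtain ⟨k, hk⟩ := Function.ne_iff.mp ha0
  have ha3 := ha
  have hb3 := hb
  rw [Fin.sum_univ_three] at ha3 hb3
  have hpar : ∀ k : Fin 3,
      (a k : ℂ) * ((q₂ : ℂ) * ((Real.sqrt D : ℝ) : ℂ)) = (b k : ℂ) * (q₁ : ℂ) := by
    intro k
    rw [← ha3, ← hb3]
    match k with
    | 0 => linear_combination (z 1) * h2 - (z 2) * h1
    | 1 => linear_combination (-(z 0)) * h2 + (z 2) * h0
    | 2 => linear_combination (z 0) * h1 - (z 1) * h0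
  have hR : (a k : ℝ) * ((q₂ : ℝ) * Real.sqrt D) = (b k : ℝ) * (q₁ : ℝ) := by
    exact_mod_cast hpar k
  have hkR : (a k : ℝ) ≠ 0 := by exact_mod_cast hk
  have hq₂R : (q₂ : ℝ) ≠ 0 := by exact_mod_cast hq₂
  have hsq : Real.sqrt D = (b k : ℝ) * (q₁ : ℝ) / ((a k : ℝ) * (q₂ : ℝ)) := by
    rw [eq_div_iff (mul_ne_zero hkR hq₂R)]; linarith
  exact hD ⟨(b k : ℚ) * q₁ / ((a k : ℚ) * q₂), by push_cast; exact hsq.symm⟩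

/-- `(q : ℝ) · den q = num q`. -/
private theorem ratCast_mul_den (q : ℚ) : (q : ℝ) * q.den = q.num := by
  exact_mod_cast Rat.mul_den_eq_num q

/-- **LEMMA L (the small forms are genuinely ternary).**  For every sufficiently high level `m`, a
non-zero form `h·z` of size `< exp(−(1+|h|₁)^m)` has `c·h ≠ 0`: otherwise `c_j (h·z) = A q₁ + B q₂√D`
with `(A, B) ≠ 0` of height `≪ |h|₁`, contradicting Liouville's inequality in `ℚ(√D)`. -/
theorem exists_level_dot_ne_zero {z : Fin 3 → ℂ} (hz : LinearIndependent ℚ z) {D : ℕ}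
    (hD : Irrational (Real.sqrt D)) {q₁ q₂ : ℚ} (hq₁ : q₁ ≠ 0) (hq₂ : q₂ ≠ 0) {a b : Fin 3 → ℤ}
    (ha : ∑ i, (a i : ℂ) * z i = (q₁ : ℂ)) (hb : ∑ i, (b i : ℂ) * z i = (q₂ : ℂ) * ((Real.sqrt D : ℝ) : ℂ))
    {j : Fin 3} (hj : cvec a b j ≠ 0) :
    ∃ mL : ℕ, ∀ m : ℕ, mL ≤ m → ∀ h : Fin 3 → ℤ, h ≠ 0 →
      ‖∑ i, (h i : ℂ) * z i‖ < Real.exp (-((1 + ∑ i, |(h i : ℝ)|) ^ m)) →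
        (∑ i, cvec a b i * h i) ≠ 0 := by
  -- constants
  have hs0 : 0 ≤ Real.sqrt D := Real.sqrt_nonneg _
  set Sa : ℝ := ∑ i, |(a i : ℝ)| with hSa
  set Sb : ℝ := ∑ i, |(b i : ℝ)| with hSb
  have hSa0 : 0 ≤ Sa := Finset.sum_nonneg fun _ _ => abs_nonneg _
  have hSb0 : 0 ≤ Sb := Finset.sum_nonneg fun _ _ => abs_nonneg _
  have hd₁pos : (0 : ℝ) < q₁.den := by exact_mod_cast q₁.den_pos
  have hd₂pos : (0 : ℝ) < q₂.den := by exact_mod_cast q₂.den_pos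
  have hn₁0 : q₁.num ≠ 0 := Rat.num_ne_zero.mpr hq₁
  have hn₂0 : q₂.num ≠ 0 := Rat.num_ne_zero.mpr hq₂
  have hq₁R : (q₁ : ℝ) * q₁.den = q₁.num := ratCast_mul_den q₁
  have hq₂R : (q₂ : ℝ) * q₂.den = q₂.num := ratCast_mul_den q₂
  have hcj1 : 1 ≤ |(cvec a b j : ℝ)| := by
    rw [← Int.cast_abs]; exact_mod_cast Int.one_le_abs hj
  have hcj0 : 0 < |(cvec a b j : ℝ)| := by linarith
  set κ : ℝ := 1 + |(q₁.num : ℝ)| * q₂.den * Sb + |(q₂.num : ℝ)| * q₁.den * Sa * (Real.sqrt D + 1)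
    with hκ
  have hκ1 : 1 ≤ κ := by
    have : 0 ≤ |(q₁.num : ℝ)| * q₂.den * Sb + |(q₂.num : ℝ)| * q₁.den * Sa * (Real.sqrt D + 1) := by
      positivity
    rw [hκ]; linarith
  have hκ0 : 0 < κ := by linarith
  set κ₀ : ℝ := (q₁.den : ℝ) * q₂.den * |(cvec a b j : ℝ)| with hκ₀
  have hκ₀0 : 0 < κ₀ := by positivity
  set κ₁ : ℝ := κ₀ * κ with hκ₁
  obtain ⟨T, hT⟩ := exists_le_two_pow κ₁
  refine ⟨T + 1, fun m hm h hh hsmall hC => ?_⟩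
  obtain ⟨m', rfl⟩ : ∃ m', m = m' + 1 := ⟨m - 1, by omega⟩
  set Sh : ℝ := ∑ i, |(h i : ℝ)| with hSh
  set W : ℝ := 1 + Sh with hW
  have hSh1 : 1 ≤ Sh := one_le_hsum hh
  have hW2 : 2 ≤ W := by rw [hW]; linarith only [hSh1]
  have hW1 : 1 ≤ W := by linarith only [hW2]
  have hW0 : 0 < W := by linarith only [hW2]
  have hShW : Sh ≤ W := by rw [hW]; linarith only [hSh1]
  set F : ℂ := ∑ i, (h i : ℂ) * z i with hF
  have hF0 : F ≠ 0 := form_ne_zero_of_linearIndependent hz hh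
  -- the key identity with `C = 0`
  have hkey := cvec_key a b h z j
  rw [← hF, ha, hb, hC] at hkey
  simp only [Int.cast_zero, zero_mul, add_zero] at hkey
  set A : ℤ := cvec h b j with hA
  set B : ℤ := cvec a h j with hB
  -- the real number r = A q₁ + B q₂ √D, and U + V √D = d₁ d₂ r
  set r : ℝ := (A : ℝ) * q₁ + (B : ℝ) * (q₂ * Real.sqrt D) with hr
  have hkeyR : (cvec a b j : ℂ) * F = (r : ℂ) := by rw [hkey, hr]; push_cast; ring
  have hnormF : |(cvec a b j : ℝ)| * ‖F‖ = |r| := by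
    have := congr_arg (fun w : ℂ => ‖w‖) hkeyR
    simpa only [norm_mul, Complex.norm_intCast, Complex.norm_real, Real.norm_eq_abs] using this
  set U : ℤ := A * q₁.num * q₂.den with hU
  set V : ℤ := B * q₂.num * q₁.den with hV
  have hUV : (U : ℝ) + V * Real.sqrt D = (q₁.den : ℝ) * q₂.den * r := by
    rw [hU, hV, hr]; push_cast
    rw [← hq₁R, ← hq₂R]; ring
  have hUV0 : U ≠ 0 ∨ V ≠ 0 := by
    by_contra hn
    push Not at hn
    obtain ⟨hU0, hV0⟩ := hn
    have hA0 : A = 0 := by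
      have : A * q₁.num * (q₂.den : ℤ) = 0 := hU0
      rcases mul_eq_zero.mp this with h1 | h1
      · rcases mul_eq_zero.mp h1 with h2 | h2
        · exact h2
        · exact absurd h2 hn₁0
      · exact absurd h1 (by exact_mod_cast q₂.den_pos.ne')
    have hB0 : B = 0 := by
      have : B * q₂.num * (q₁.den : ℤ) = 0 := hV0
      rcases mul_eq_zero.mp this with h1 | h1
      · rcases mul_eq_zero.mp h1 with h2 | h2
        · exact h2
        · exact absurd h2 hn₂0
      · exact absurd h1 (by exact_mod_cast q₁.den_pos.ne')
    have hr0 : r = 0 := by rw [hr, hA0, hB0]; simp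
    have : (cvec a b j : ℂ) * F = 0 := by rw [hkeyR, hr0]; simp
    rcases mul_eq_zero.mp this with h1 | h1
    · exact hj (by exact_mod_cast h1)
    · exact hF0 h1
  -- lower bound (Liouville in ℚ(√D)) vs upper bound (smallness)
  have hlow := quad_lower_bound hD U V hUV0
  have hAle : |(A : ℝ)| ≤ Sh * Sb := abs_cvec_le h b j
  have hBle : |(B : ℝ)| ≤ Sa * Sh := abs_cvec_le a h j
  have hden : |(U : ℝ)| + |(V : ℝ)| * Real.sqrt D + 1 ≤ κ * W := by
    have h1 : |(U : ℝ)| ≤ W * (|(q₁.num : ℝ)| * q₂.den * Sb) := by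
      rw [hU]; push_cast
      simp only [abs_mul, Nat.abs_cast]
      calc |(A : ℝ)| * |(q₁.num : ℝ)| * q₂.den ≤ Sh * Sb * |(q₁.num : ℝ)| * q₂.den := by gcongr
        _ ≤ W * Sb * |(q₁.num : ℝ)| * q₂.den := by gcongr
        _ = W * (|(q₁.num : ℝ)| * q₂.den * Sb) := by ring
    have h2 : |(V : ℝ)| * Real.sqrt D ≤ W * (|(q₂.num : ℝ)| * q₁.den * Sa * (Real.sqrt D + 1)) := by
      rw [hV]; push_cast
      simp only [abs_mul, Nat.abs_cast]
      calc |(B : ℝ)| * |(q₂.num : ℝ)| * q₁.den * Real.sqrt D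
          ≤ Sa * Sh * |(q₂.num : ℝ)| * q₁.den * Real.sqrt D := by gcongr
        _ ≤ Sa * W * |(q₂.num : ℝ)| * q₁.den * (Real.sqrt D + 1) := by
            gcongr; linarith only [hShW]
        _ = W * (|(q₂.num : ℝ)| * q₁.den * Sa * (Real.sqrt D + 1)) := by ring
    have h3 : |(U : ℝ)| + |(V : ℝ)| * Real.sqrt D + 1 ≤ W * (|(q₁.num : ℝ)| * q₂.den * Sb) +
        W * (|(q₂.num : ℝ)| * q₁.den * Sa * (Real.sqrt D + 1)) + W := by
      linarith only [h1, h2, hW1]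
    calc _ ≤ _ := h3
      _ = κ * W := by rw [hκ]; ring
  have hκW : 0 < κ * W := by positivity
  have hup : |(U : ℝ) + V * Real.sqrt D| < κ₀ * Real.exp (-(W ^ (m' + 1))) := by
    rw [hUV, abs_mul, abs_mul, Nat.abs_cast, Nat.abs_cast, ← hnormF, hκ₀]
    have h1 := mul_lt_mul_of_pos_left hsmall
      (show (0 : ℝ) < (q₁.den : ℝ) * q₂.den * |(cvec a b j : ℝ)| by positivity)
    calc (q₁.den : ℝ) * q₂.den * (|(cvec a b j : ℝ)| * ‖F‖)
        = (q₁.den : ℝ) * q₂.den * |(cvec a b j : ℝ)| * ‖F‖ := by ring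
      _ < (q₁.den : ℝ) * q₂.den * |(cvec a b j : ℝ)| * Real.exp (-(W ^ (m' + 1))) := h1
  have hWp : 0 < W ^ (m' + 1) := by positivity
  have hexp : Real.exp (-(W ^ (m' + 1))) ≤ 1 / W ^ (m' + 1) := exp_neg_le_one_div' hWp
  -- combine: 1/(κ W) ≤ |U + V √D| < κ₀ / W^(m'+1)
  have h1 : 1 / (κ * W) < κ₀ / W ^ (m' + 1) := by
    calc 1 / (κ * W) ≤ 1 / (|(U : ℝ)| + |(V : ℝ)| * Real.sqrt D + 1) :=
          one_div_le_one_div_of_le (by positivity) hden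
      _ ≤ |(U : ℝ) + V * Real.sqrt D| := hlow
      _ < κ₀ * Real.exp (-(W ^ (m' + 1))) := hup
      _ ≤ κ₀ * (1 / W ^ (m' + 1)) := mul_le_mul_of_nonneg_left hexp hκ₀0.le
      _ = κ₀ / W ^ (m' + 1) := mul_one_div _ _
  have h2 : W ^ (m' + 1) < κ₁ * W := by
    rw [div_lt_div_iff₀ hκW hWp, one_mul] at h1
    calc W ^ (m' + 1) < κ₀ * (κ * W) := h1
      _ = κ₁ * W := by rw [hκ₁]; ring
  have h3 : W ^ m' < κ₁ := by
    rw [pow_succ] at h2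
    exact lt_of_mul_lt_mul_right h2 hW0.le
  have h4 : κ₁ ≤ W ^ m' :=
    calc κ₁ ≤ 2 ^ T := hT
      _ ≤ W ^ T := pow_le_pow_left₀ (by norm_num) hW2 T
      _ ≤ W ^ m' := pow_le_pow_right₀ hW1 (by omega)
  linarith only [h3, h4]

end HyperCell

end Summit.Schanuel.Schanuel.Theorems.RootDecomp1KHyper
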